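import Mathlib
import Literature.Analysis.Approximation.CoefficientBound
import Literature.Analysis.ODE.InverseSquareLadderMonomials

/-!
# The exact far kernel data `x^{2k−n}` on `(1,∞)`: energies and the coefficient bound

Analysis/PDE support file (everything proved). For the smooth `ι = 1/x` on `[½,∞)` and `n ≥ 1`,
the even inverse powers `ι^{n−2k}` (`k ≤ n/2`: position data; `k < (n+1)/2`: velocity data) span the
Cauchy data of the non-radiating `t`-polynomial solutions of the exact inverse-square wave equation
on the unit far cone (`InverseSquareLadderMonomials.lean`). This file records their calculus on
`(1,∞)` (`hasDerivAt_iota_pow`, integrability of `ι^p`, `p ≥ 2`) and instantiates the abstract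
coefficient bound (`Literature.Analysis.Approximation.exists_sum_abs_le_sqrt_integral`) for the two
families in the exact energy norm:

* `exists_coeffBound_position` : `Σ_{k ≤ n/2} |α_k| ≤ Λ √(∫_{x>1} (P')² + n(n+1)ι²P²)`,
  `P = Σ α_k ι^{n−2k}`;
* `exists_coeffBound_velocity` : `Σ_{k<(n+1)/2} |β_k| ≤ Λ' √(∫_{x>1} Q²)`, `Q = Σ β_k ι^{n−2k}`,

the linear independence being that of distinct even powers (a polynomial vanishing on `(1,∞)` is
zero). These constants turn per-power approximation of the exact kernel by the true one into
approximation of the whole kernel (hypothesis `happrox` of `kernel_absorption`) in the far-side channel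
estimate of `FixedModeChannels` (route PhotonSphereChannels, stmt-FinalStateConjecture-10048).
Folklore.
-/

noncomputable section

namespace Literature.Analysis.PDE

open Set Filter MeasureTheory Finset Polynomial Literature.Analysis.Approximation
open scoped _root_.Topology

variable {ι : ℝ → ℝ}

section Iota

variable (hι : ContDiff ℝ (⊤ : ℕ∞) ι) (hιeq : ∀ x : ℝ, 1 / 2 ≤ x → ι x = x⁻¹)
include hι hιeq

omit hι in
/-- `ι` is differentiable with `ι' = −ι²` on `x > ½`. [folklore] -/
theorem hasDerivAt_iota {x : ℝ} (hx : 1 / 2 < x) : HasDerivAt ι (-(ι x) ^ 2) x := by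
  have hx0 : x ≠ 0 := by intro h; rw [h] at hx; norm_num at hx
  have hev : ι =ᶠ[𝓝 x] fun y => y⁻¹ :=
    Filter.mem_of_superset (Ioi_mem_nhds hx) fun y hy => hιeq y (le_of_lt hy)
  have h1 : HasDerivAt (fun y : ℝ => y⁻¹) (-(x ^ 2)⁻¹) x := hasDerivAt_inv hx0
  rw [hιeq x hx.le, inv_pow]
  exact h1.congr_of_eventuallyEq hev

omit hι in
/-- `(ι^m)' = −m ι^{m+1}` on `x > ½`. [folklore] -/
theorem hasDerivAt_iota_pow (m : ℕ) {x : ℝ} (hx : 1 / 2 < x) :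
    HasDerivAt (fun y => ι y ^ m) (-(m : ℝ) * ι x ^ (m + 1)) x := by
  have h := (hasDerivAt_iota hιeq hx).pow m
  have e : (m : ℝ) * ι x ^ (m - 1) * (-(ι x) ^ 2) = -(m : ℝ) * ι x ^ (m + 1) := by
    rcases Nat.eq_zero_or_pos m with hm | hm
    · subst hm; simp
    · have : ι x ^ (m + 1) = ι x ^ (m - 1) * ι x ^ 2 := by
        rw [← pow_add]; congr 1; omega
      rw [this]; ring
  rw [← e]
  exact h

omit hι in
/-- `deriv (ι^m) = −m ι^{m+1}` on `x > ½`. [folklore] -/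
theorem deriv_iota_pow (m : ℕ) {x : ℝ} (hx : 1 / 2 < x) :
    deriv (fun y => ι y ^ m) x = -(m : ℝ) * ι x ^ (m + 1) :=
  (hasDerivAt_iota_pow hιeq m hx).deriv

omit hι in
/-- On `[1,∞)`: `0 < ι x ≤ 1` and `ι x ^ p ≤ x⁻²` for `p ≥ 2`. [folklore] -/
theorem iota_pow_le {x : ℝ} (hx : 1 ≤ x) {p : ℕ} (hp : 2 ≤ p) :
    0 < ι x ∧ ι x ≤ 1 ∧ ι x ^ p ≤ (x ^ 2)⁻¹ := by
  have hx0 : 0 < x := by linarith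
  rw [hιeq x (by linarith)]
  refine ⟨inv_pos.2 hx0, inv_le_one_of_one_le₀ hx, ?_⟩
  rw [← inv_pow]
  exact pow_le_pow_of_le_one (inv_nonneg.2 hx0.le) (inv_le_one_of_one_le₀ hx) hp

/-- `ι^p` is integrable on `(1,∞)` for `p ≥ 2`. [folklore] -/
theorem integrableOn_iota_pow {p : ℕ} (hp : 2 ≤ p) : IntegrableOn (fun x => ι x ^ p) (Ioi 1) := by
  have hdom : IntegrableOn (fun x : ℝ => x ^ (-(2 : ℝ))) (Ioi 1) :=
    integrableOn_Ioi_rpow_of_lt (by norm_num) one_pos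
  refine Integrable.mono' hdom ((hι.continuous.pow p).aestronglyMeasurable)
    ((ae_restrict_iff' measurableSet_Ioi).2 (ae_of_all _ fun x hx => ?_))
  have hx1 : (1 : ℝ) ≤ x := le_of_lt hx
  obtain ⟨h0, -, h2⟩ := iota_pow_le hιeq hx1 hp
  rw [Real.norm_eq_abs, abs_of_nonneg (pow_nonneg h0.le _), Real.rpow_neg (by linarith),
    show (2 : ℝ) = ((2 : ℕ) : ℝ) by norm_num, Real.rpow_natCast]
  exact h2

/-- A bounded continuous multiple of `ι^p` (`p ≥ 2`) is integrable on `(1,∞)`: if `|f| ≤ C` on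
`(1,∞)` and `f` is continuous then `f ι^p` is integrable there. [folklore] -/
theorem integrableOn_mul_iota_pow {f : ℝ → ℝ} (hf : Continuous f) {C : ℝ}
    (hfC : ∀ x, 1 < x → |f x| ≤ C) {p : ℕ} (hp : 2 ≤ p) :
    IntegrableOn (fun x => f x * ι x ^ p) (Ioi 1) := by
  refine Integrable.mono' ((integrableOn_iota_pow hι hιeq hp).const_mul C)
    ((hf.mul (hι.continuous.pow p)).aestronglyMeasurable)
    ((ae_restrict_iff' measurableSet_Ioi).2 (ae_of_all _ fun x hx => ?_))
  have h0 : 0 ≤ ι x ^ p := pow_nonneg (iota_pow_le hιeq (le_of_lt hx) hp).1.le _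
  rw [Real.norm_eq_abs, abs_mul, abs_of_nonneg h0]
  exact mul_le_mul_of_nonneg_right (hfC x hx) h0

end Iota

/-! ### Independence of distinct even powers on `(1,∞)` -/

/-- If `Σ_{i<m} c_i x^{2i} = 0` for all `x > 1` then `c = 0`. [folklore] -/
theorem eq_zero_of_sum_even_pow_eq_zero {m : ℕ} (c : Fin m → ℝ)
    (h : ∀ x : ℝ, 1 < x → ∑ i, c i * x ^ (2 * (i : ℕ)) = 0) : c = 0 := by
  classical
  set p : ℝ[X] := ∑ i : Fin m, C (c i) * X ^ (2 * (i : ℕ)) with hp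
  have heval : ∀ x : ℝ, p.eval x = ∑ i, c i * x ^ (2 * (i : ℕ)) := fun x => by
    simp [hp, eval_finsetSum]
  have hroots : {x | p.IsRoot x}.Infinite := by
    refine Set.Infinite.mono (fun x hx => ?_) (Set.Ioi_infinite (1 : ℝ))
    show p.IsRoot x
    rw [IsRoot.def, heval, h x hx]
  have hp0 : p = 0 := eq_zero_of_infinite_isRoot p hroots
  funext j
  have hc : p.coeff (2 * (j : ℕ)) = c j := by
    rw [hp, finsetSum_coeff]
    simp only [coeff_C_mul_X_pow]
    rw [Finset.sum_eq_single j]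
    · simp
    · intro i _ hij
      rw [if_neg]
      intro h2
      exact hij (Fin.ext (by omega))
    · intro h'; exact absurd (Finset.mem_univ j) h'
  rw [← hc, hp0, coeff_zero]
  rfl

section Families

variable (hι : ContDiff ℝ (⊤ : ℕ∞) ι) (hιeq : ∀ x : ℝ, 1 / 2 ≤ x → ι x = x⁻¹) {n : ℕ} (hn : 1 ≤ n)
include hι hιeq hn

/-- **Coefficient bound for the position family** `ι^{n−2k}`, `k ≤ n/2`, in the exact energy norm on
`(1,∞)` (`n ≥ 1`). [folklore] -/
theorem exists_coeffBound_position :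
    ∃ Λ : ℝ, 0 ≤ Λ ∧ ∀ α : ℕ → ℝ,
      IntegrableOn (fun x => deriv (fun y => ∑ k ∈ range (n / 2 + 1), α k * ι y ^ (n - 2 * k)) x ^ 2
        + (n : ℝ) * (n + 1) * ι x ^ 2
          * (∑ k ∈ range (n / 2 + 1), α k * ι x ^ (n - 2 * k)) ^ 2) (Ioi 1) ∧
      ∑ k ∈ range (n / 2 + 1), |α k| ≤ Λ * Real.sqrt (∫ x in Ioi 1,
        (deriv (fun y => ∑ k ∈ range (n / 2 + 1), α k * ι y ^ (n - 2 * k)) x ^ 2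
        + (n : ℝ) * (n + 1) * ι x ^ 2
          * (∑ k ∈ range (n / 2 + 1), α k * ι x ^ (n - 2 * k)) ^ 2)) := by
  set m : ℕ := n / 2 + 1 with hm
  set s : ℝ := Real.sqrt ((n : ℝ) * (n + 1)) with hs
  have hs2 : s ^ 2 = (n : ℝ) * (n + 1) := Real.sq_sqrt (by positivity)
  have hs0 : 0 < s := Real.sqrt_pos.2 (by positivity)
  -- the families
  set A : Fin m → ℝ → ℝ := fun i x => deriv (fun y => ι y ^ (n - 2 * (i : ℕ))) x with hA
  set B : Fin m → ℝ → ℝ := fun i x => s * ι x * ι x ^ (n - 2 * (i : ℕ)) with hB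
  have hAc : ∀ i, Continuous (A i) := fun i => (hι.pow _).continuous_deriv (by simp)
  have hBc : ∀ i, Continuous (B i) := fun i =>
    (continuous_const.mul hι.continuous).mul (hι.continuous.pow _)
  -- square integrability on `(1,∞)`
  have hAeq : ∀ (i : Fin m) x, 1 < x → A i x = -((n - 2 * (i : ℕ) : ℕ) : ℝ) * ι x ^ (n - 2 * (i : ℕ) + 1) :=
    fun i x hx => deriv_iota_pow hιeq _ (by linarith)
  have hA2 : ∀ i, IntegrableOn (fun x => A i x ^ 2) (Ioi 1) := by
    intro i
    have h := integrableOn_mul_iota_pow hι hιeq (f := fun _ => (((n - 2 * (i : ℕ) : ℕ) : ℝ)) ^ 2)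
      continuous_const (C := (((n - 2 * (i : ℕ) : ℕ) : ℝ)) ^ 2) (fun x _ => le_of_eq (abs_of_nonneg (sq_nonneg _)))
      (p := 2 * (n - 2 * (i : ℕ) + 1)) (by omega)
    refine h.congr_fun (fun x hx => ?_) measurableSet_Ioi
    show (((n - 2 * (i : ℕ) : ℕ) : ℝ)) ^ 2 * ι x ^ (2 * (n - 2 * (i : ℕ) + 1)) = A i x ^ 2
    rw [hAeq i x hx, pow_mul']; ring
  have hB2 : ∀ i, IntegrableOn (fun x => B i x ^ 2) (Ioi 1) := by
    intro i
    have h := integrableOn_mul_iota_pow hι hιeq (f := fun _ => s ^ 2) continuous_const (C := s ^ 2)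
      (fun x _ => le_of_eq (abs_of_nonneg (sq_nonneg _))) (p := 2 * (n - 2 * (i : ℕ) + 1)) (by omega)
    refine h.congr_fun (fun x _ => ?_) measurableSet_Ioi
    show s ^ 2 * ι x ^ (2 * (n - 2 * (i : ℕ) + 1)) = (s * ι x * ι x ^ (n - 2 * (i : ℕ))) ^ 2
    rw [pow_mul']; ring
  -- independence of the `B`-family
  have hindep : ∀ c : Fin m → ℝ, (∀ x ∈ Ioi (1 : ℝ), ∑ i, c i * B i x = 0) → c = 0 := by
    intro c hc
    refine eq_zero_of_sum_even_pow_eq_zero c fun x hx => ?_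
    have hx0 : x ≠ 0 := by linarith
    have h0 := hc x hx
    have hιx : ι x = x⁻¹ := hιeq x (by linarith [show (1:ℝ) < x from hx])
    -- `Σ c_i B_i x = s x⁻¹ x⁻ⁿ Σ c_i x^{2i}`
    have key : ∑ i, c i * B i x = s * x⁻¹ * (x ^ n)⁻¹ * ∑ i, c i * x ^ (2 * (i : ℕ)) := by
      rw [Finset.mul_sum]
      refine Finset.sum_congr rfl fun i _ => ?_
      have hi : 2 * (i : ℕ) ≤ n := by
        have := i.2; simp only [hm] at this; omega
      simp only [hB, hιx]
      have hsplit : x ^ n = x ^ (2 * (i : ℕ)) * x ^ (n - 2 * (i : ℕ)) := by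
        rw [← pow_add, Nat.add_sub_cancel' hi]
      have e : (x⁻¹) ^ (n - 2 * (i : ℕ)) = (x ^ n)⁻¹ * x ^ (2 * (i : ℕ)) := by
        rw [inv_pow, hsplit]; field_simp
      rw [e]; ring
    rw [key] at h0
    have hne : s * x⁻¹ * (x ^ n)⁻¹ ≠ 0 := by
      refine mul_ne_zero (mul_ne_zero hs0.ne' (inv_ne_zero hx0)) (inv_ne_zero (pow_ne_zero _ hx0))
    exact (mul_eq_zero.1 h0).resolve_left hne
  obtain ⟨Λ, hΛ0, hΛ⟩ := exists_sum_abs_le_sqrt_integral A B 1 hAc hBc hA2 hB2 hindep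
  refine ⟨Λ, hΛ0, fun α => ?_⟩
  obtain ⟨hint, hle⟩ := hΛ (fun i : Fin m => α (i : ℕ))
  -- identify the combinations
  have hsumA : ∀ x, ∑ i : Fin m, α (i : ℕ) * A i x
      = deriv (fun y => ∑ k ∈ range (n / 2 + 1), α k * ι y ^ (n - 2 * k)) x := by
    intro x
    rw [deriv_fun_sum fun k _ => ((hι.pow _).differentiable (by simp) x).const_mul _]
    rw [← hm, ← Fin.sum_univ_eq_sum_range]
    refine Finset.sum_congr rfl fun i _ => ?_
    rw [deriv_const_mul _ ((hι.pow _).differentiable (by simp) x)]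
  have hsumB : ∀ x, (∑ i : Fin m, α (i : ℕ) * B i x) ^ 2
      = (n : ℝ) * (n + 1) * ι x ^ 2 * (∑ k ∈ range (n / 2 + 1), α k * ι x ^ (n - 2 * k)) ^ 2 := by
    intro x
    have : ∑ i : Fin m, α (i : ℕ) * B i x = s * ι x * ∑ k ∈ range (n / 2 + 1), α k * ι x ^ (n - 2 * k) := by
      rw [Finset.mul_sum, ← hm, ← Fin.sum_univ_eq_sum_range]
      refine Finset.sum_congr rfl fun i _ => ?_
      simp only [hB]; ring
    rw [this, mul_pow, mul_pow, hs2]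
  have hsumabs : ∑ i : Fin m, |α (i : ℕ)| = ∑ k ∈ range (n / 2 + 1), |α k| := by
    rw [← hm, ← Fin.sum_univ_eq_sum_range]
  have hfun : (fun x => (∑ i : Fin m, α (i : ℕ) * A i x) ^ 2 + (∑ i : Fin m, α (i : ℕ) * B i x) ^ 2)
      = fun x => deriv (fun y => ∑ k ∈ range (n / 2 + 1), α k * ι y ^ (n - 2 * k)) x ^ 2
        + (n : ℝ) * (n + 1) * ι x ^ 2 * (∑ k ∈ range (n / 2 + 1), α k * ι x ^ (n - 2 * k)) ^ 2 := by
    funext x; rw [hsumA x, hsumB x]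
  rw [hfun] at hint hle
  rw [hsumabs] at hle
  exact ⟨hint, hle⟩

omit hn in
/-- **Coefficient bound for the velocity family** `ι^{n−2k}`, `k < (n+1)/2`, in `L²(1,∞)`.
[folklore] -/
theorem exists_coeffBound_velocity :
    ∃ Λ : ℝ, 0 ≤ Λ ∧ ∀ β : ℕ → ℝ,
      IntegrableOn (fun x => (∑ k ∈ range ((n + 1) / 2), β k * ι x ^ (n - 2 * k)) ^ 2) (Ioi 1) ∧
      ∑ k ∈ range ((n + 1) / 2), |β k| ≤ Λ * Real.sqrt (∫ x in Ioi 1,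
        (∑ k ∈ range ((n + 1) / 2), β k * ι x ^ (n - 2 * k)) ^ 2) := by
  set m : ℕ := (n + 1) / 2 with hm
  set A : Fin m → ℝ → ℝ := fun _ _ => 0 with hA
  set B : Fin m → ℝ → ℝ := fun i x => ι x ^ (n - 2 * (i : ℕ)) with hB
  have hAc : ∀ i, Continuous (A i) := fun i => continuous_const
  have hBc : ∀ i, Continuous (B i) := fun i => hι.continuous.pow _
  have hA2 : ∀ i, IntegrableOn (fun x => A i x ^ 2) (Ioi 1) := fun i => by
    simp only [hA]; simp
  have hB2 : ∀ i, IntegrableOn (fun x => B i x ^ 2) (Ioi 1) := by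
    intro i
    have hi : 1 ≤ n - 2 * (i : ℕ) := by
      have := i.2; simp only [hm] at this; omega
    have h := integrableOn_iota_pow hι hιeq (p := 2 * (n - 2 * (i : ℕ))) (by omega)
    refine h.congr_fun (fun x _ => ?_) measurableSet_Ioi
    show ι x ^ (2 * (n - 2 * (i : ℕ))) = (ι x ^ (n - 2 * (i : ℕ))) ^ 2
    rw [pow_mul']
  have hindep : ∀ c : Fin m → ℝ, (∀ x ∈ Ioi (1 : ℝ), ∑ i, c i * B i x = 0) → c = 0 := by
    intro c hc
    refine eq_zero_of_sum_even_pow_eq_zero c fun x hx => ?_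
    have hx0 : x ≠ 0 := by linarith
    have h0 := hc x hx
    have hιx : ι x = x⁻¹ := hιeq x (by linarith [show (1:ℝ) < x from hx])
    have key : ∑ i, c i * B i x = (x ^ n)⁻¹ * ∑ i, c i * x ^ (2 * (i : ℕ)) := by
      rw [Finset.mul_sum]
      refine Finset.sum_congr rfl fun i _ => ?_
      have hi : 2 * (i : ℕ) ≤ n := by
        have := i.2; simp only [hm] at this; omega
      simp only [hB, hιx]
      have hsplit : x ^ n = x ^ (2 * (i : ℕ)) * x ^ (n - 2 * (i : ℕ)) := by
        rw [← pow_add, Nat.add_sub_cancel' hi]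
      have e : (x⁻¹) ^ (n - 2 * (i : ℕ)) = (x ^ n)⁻¹ * x ^ (2 * (i : ℕ)) := by
        rw [inv_pow, hsplit]; field_simp
      rw [e]; ring
    rw [key] at h0
    exact (mul_eq_zero.1 h0).resolve_left (inv_ne_zero (pow_ne_zero _ hx0))
  obtain ⟨Λ, hΛ0, hΛ⟩ := exists_sum_abs_le_sqrt_integral A B 1 hAc hBc hA2 hB2 hindep
  refine ⟨Λ, hΛ0, fun β => ?_⟩
  obtain ⟨hint, hle⟩ := hΛ (fun i : Fin m => β (i : ℕ))
  have hsumB : ∀ x, ∑ i : Fin m, β (i : ℕ) * B i x = ∑ k ∈ range ((n + 1) / 2), β k * ι x ^ (n - 2 * k) := by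
    intro x
    rw [← hm, ← Fin.sum_univ_eq_sum_range]
  have hsumabs : ∑ i : Fin m, |β (i : ℕ)| = ∑ k ∈ range ((n + 1) / 2), |β k| := by
    rw [← hm, ← Fin.sum_univ_eq_sum_range]
  have hfun : (fun x => (∑ i : Fin m, β (i : ℕ) * A i x) ^ 2 + (∑ i : Fin m, β (i : ℕ) * B i x) ^ 2)
      = fun x => (∑ k ∈ range ((n + 1) / 2), β k * ι x ^ (n - 2 * k)) ^ 2 := by
    funext x; rw [hsumB x]; simp [hA]
  rw [hfun] at hint hle
  rw [hsumabs] at hle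
  exact ⟨hint, hle⟩

end Families

end Literature.Analysis.PDE
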